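import Literature.AnabelianGeometry.EtaleTheta.SettingModel2Coverings
import HarnessLib

/-!
# A FINER model of the [EtTh] §1 root, part B3: twist-stability of `Δ^tp_{Y_N}`, `Δ^tp_{Z_N}` (for the χ-twisted model)

Mochizuki, *The étale theta function …*, Publ. RIMS **45** (2009) [EtTh], §1, PRIMS PDF pp. 13–14
[cite: MochizukiEtTh2009, §1 p.13]: "`Δ^tp_Y/Δ^tp_{Y_N} ≅ ℤ/Nℤ(1)`", "`Gal(Z_N/Y_N) ≅ Δ_Θ ⊗ ℤ/Nℤ ≅ ℤ/Nℤ(1)`" — the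
Galois group `G_K` acts on these layers through the CYCLOTOMIC CHARACTER, trivially once `μ_N ⊆ K_N`. Layer L2 of the
abc-iut cell, seat abc-iut-L2-t1 (root owner); sequel of `SettingModel2Coverings` written for the χ-TWISTED root model
(abc-iut R78 reshape (B), file map R100: `Π^tp_X := Γ ⋊_χ G_{ℚ_p}`, `Γ = F̂₂ ×_Ẑ ℤ`), stated ABSTRACTLY so that it does
not depend on the twist's construction: for an endomorphism `θ` of `Γ` that preserves the degree `pr₂` and is read
through the level map `Γ → Heis(ℤ/N)` by a map `δ` preserving the `z`-axis (resp. the identity — the case `χ ≡ 1 mod N`,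
i.e. `σ ∈ G_{K_N}`), the level subgroups `Δ^tp_{Y_N}`, `Δ^tp_{Z_N}` are `θ`-STABLE, and `γ · θ(γ)⁻¹ ∈ Δ^tp_{Z_N}` for
every `γ ∈ Γ` (so `G_{K_N}` acts trivially on `Γ/Δ^tp_{Y_N}`, `G_{J_N}` on `Γ/Δ^tp_{Z_N}`): exactly the hypotheses
`h` / `hstab` / `htriv` of `SettingModel.Semidirect.twistedProd` / `twistedProd_normal`. Model plumbing only; nothing of
[EtTh] asserted; no side taken on [IUTchIII] Cor. 3.12.
-/

noncomputable section

namespace Literature.AnabelianGeometry.EtaleTheta.SettingModel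

open Literature.AnabelianGeometry.SemiGraphs
open Function

/-- **`Δ^tp_{Y_N}` is stable** under a degree-preserving endomorphism `θ` of `Γ` whose effect on the level map is a
`z`-axis-preserving map `δ` (the twist `θ_u`: `δ = (x, y, z) ↦ (x, uy, uz)`). [cite: MochizukiEtTh2009, §1 p.13] -/
theorem map_mem_dY {N : ℕ+} (θ : Gfp →* Gfp) (hdeg : ∀ γ, gfpSnd (θ γ) = gfpSnd γ)
    (δ : Heis (ZMod N) → Heis (ZMod N)) (hδ : ∀ ⦃h⦄, h ∈ (Heis.zAxis : Subgroup (Heis (ZMod N))) → δ h ∈ Heis.zAxis)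
    (hlev : ∀ γ, levelHom N (θ γ) = δ (levelHom N γ)) {γ : Gfp} (hγ : γ ∈ dY N) : θ γ ∈ dY N := by
  obtain ⟨h1, h2⟩ := Subgroup.mem_inf.mp hγ
  refine Subgroup.mem_inf.mpr ⟨?_, Subgroup.mem_comap.mpr ?_⟩
  · rw [MonoidHom.mem_ker] at h1 ⊢
    rw [hdeg, h1]
  · rw [hlev]
    exact hδ (Subgroup.mem_comap.mp h2)

/-- **`Δ^tp_{Z_N}` is stable** under such a `θ` when moreover `δ 1 = 1`. [cite: MochizukiEtTh2009, §1 p.14] -/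
theorem map_mem_dZ {N : ℕ+} (θ : Gfp →* Gfp) (hdeg : ∀ γ, gfpSnd (θ γ) = gfpSnd γ)
    (δ : Heis (ZMod N) → Heis (ZMod N)) (hδ1 : δ 1 = 1)
    (hlev : ∀ γ, levelHom N (θ γ) = δ (levelHom N γ)) {γ : Gfp} (hγ : γ ∈ dZ N) : θ γ ∈ dZ N := by
  obtain ⟨h1, h2⟩ := Subgroup.mem_inf.mp hγ
  refine Subgroup.mem_inf.mpr ⟨?_, ?_⟩
  · rw [MonoidHom.mem_ker] at h1 ⊢
    rw [hdeg, h1]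
  · rw [MonoidHom.mem_ker] at h2 ⊢
    rw [hlev, h2, hδ1]

/-- The same, packaged as inclusions of images. [cite: MochizukiEtTh2009, §1 p.13] -/
theorem map_dY_le {N : ℕ+} (θ : Gfp →* Gfp) (hdeg : ∀ γ, gfpSnd (θ γ) = gfpSnd γ)
    (δ : Heis (ZMod N) → Heis (ZMod N)) (hδ : ∀ ⦃h⦄, h ∈ (Heis.zAxis : Subgroup (Heis (ZMod N))) → δ h ∈ Heis.zAxis)
    (hlev : ∀ γ, levelHom N (θ γ) = δ (levelHom N γ)) : (dY N).map θ ≤ dY N := by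
  rintro _ ⟨γ, hγ, rfl⟩
  exact map_mem_dY θ hdeg δ hδ hlev hγ

/-- [cite: MochizukiEtTh2009, §1 p.14] -/
theorem map_dZ_le {N : ℕ+} (θ : Gfp →* Gfp) (hdeg : ∀ γ, gfpSnd (θ γ) = gfpSnd γ)
    (δ : Heis (ZMod N) → Heis (ZMod N)) (hδ1 : δ 1 = 1)
    (hlev : ∀ γ, levelHom N (θ γ) = δ (levelHom N γ)) : (dZ N).map θ ≤ dZ N := by
  rintro _ ⟨γ, hγ, rfl⟩
  exact map_mem_dZ θ hdeg δ hδ1 hlev hγ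

/-- **Trivial action on `Γ/Δ^tp_{Z_N}`** (a fortiori on `Γ/Δ^tp_{Y_N}`): if `θ` preserves the degree and the level-`N`
map outright (`χ(σ) ≡ 1 mod N`, i.e. `σ` fixes `μ_N`), then `γ · θ(γ)⁻¹ ∈ Δ^tp_{Z_N}` for EVERY `γ ∈ Γ`.
[cite: MochizukiEtTh2009, §1 p.14] -/
theorem mul_inv_map_mem_dZ {N : ℕ+} (θ : Gfp →* Gfp) (hdeg : ∀ γ, gfpSnd (θ γ) = gfpSnd γ)
    (hlev : ∀ γ, levelHom N (θ γ) = levelHom N γ) (γ : Gfp) : γ * (θ γ)⁻¹ ∈ dZ N := by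
  refine Subgroup.mem_inf.mpr ⟨?_, ?_⟩
  · rw [MonoidHom.mem_ker, map_mul, map_inv, hdeg, mul_inv_cancel]
  · rw [MonoidHom.mem_ker, map_mul, map_inv, hlev, mul_inv_cancel]

/-- [cite: MochizukiEtTh2009, §1 p.13] -/
theorem mul_inv_map_mem_dY {N : ℕ+} (θ : Gfp →* Gfp) (hdeg : ∀ γ, gfpSnd (θ γ) = gfpSnd γ)
    (hlev : ∀ γ, levelHom N (θ γ) = levelHom N γ) (γ : Gfp) : γ * (θ γ)⁻¹ ∈ dY N :=
  dZ_le_dY N (mul_inv_map_mem_dZ θ hdeg hlev γ)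

/-- **`Ker pr₂` is stable** under every degree-preserving `θ` (the case `N = 1`: `Δ^tp_Y`).
[cite: MochizukiEtTh2009, §1 p.12] -/
theorem map_mem_ker_gfpSnd (θ : Gfp →* Gfp) (hdeg : ∀ γ, gfpSnd (θ γ) = gfpSnd γ) {γ : Gfp}
    (hγ : γ ∈ gfpSnd.ker) : θ γ ∈ gfpSnd.ker := by
  rw [MonoidHom.mem_ker] at hγ ⊢
  rw [hdeg, hγ]

/-- If `δ` is the identity on the `z`-axis, then `θ` acts trivially on `Δ^tp_{Y_N}/Δ^tp_{Z_N}`: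
`γ · θ(γ)⁻¹ ∈ Δ^tp_{Z_N}` for `γ ∈ Δ^tp_{Y_N}` ("`Gal(Z_N/Y_N) ≅ ℤ/Nℤ(1)`"). [cite: MochizukiEtTh2009, §1 p.14] -/
theorem mul_inv_map_mem_dZ_of_mem_dY {N : ℕ+} (θ : Gfp →* Gfp) (hdeg : ∀ γ, gfpSnd (θ γ) = gfpSnd γ)
    (δ : Heis (ZMod N) → Heis (ZMod N)) (hδz : ∀ ⦃h⦄, h ∈ (Heis.zAxis : Subgroup (Heis (ZMod N))) → δ h = h)
    (hlev : ∀ γ, levelHom N (θ γ) = δ (levelHom N γ)) {γ : Gfp} (hγ : γ ∈ dY N) : γ * (θ γ)⁻¹ ∈ dZ N := by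
  have hz : levelHom N γ ∈ (Heis.zAxis : Subgroup (Heis (ZMod N))) := Subgroup.mem_comap.mp (Subgroup.mem_inf.mp hγ).2
  refine Subgroup.mem_inf.mpr ⟨?_, ?_⟩
  · rw [MonoidHom.mem_ker, map_mul, map_inv, hdeg, mul_inv_cancel]
  · rw [MonoidHom.mem_ker, map_mul, map_inv, hlev, hδz hz, mul_inv_cancel]

end Literature.AnabelianGeometry.EtaleTheta.SettingModel

end
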